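import Literature.MathematicalPhysics.KineticTheory.RiemannLocalGibbsLaw
import Literature.Analysis.FunctionSpaces.PoissonDistinctValues
import Literature.Analysis.FunctionSpaces.PoissonPointProcessProofs
import HarnessLib

/-!
# Hard-core void probabilities of a finite Poisson gas: the first-point recursion and its decay

Topic `Literature/MathematicalPhysics/KineticTheory`; PROOFS (no definitions, no named facts),
first file towards the discharge of the named fact
`Literature.MathematicalPhysics.KineticTheory.RiemannLocalGibbsExistsUnique` of
`RiemannLocalGibbsLaw.lean` (existence and uniqueness of the Riemann local Gibbs law of the hard-sphere
gas at small activity).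

Setting: hard-core diameter `σ`, a probability law `P` on locally finite simple configurations of
the phase space `Phase = ℝ³ × ℝ³` which is a Poisson point process with FINITE intensity `m`
(`IsPoissonPointProcess m P`; in the application `P = poissonLaw (ν|_{Λ × ℝ³})`, the reference
process of the specification `hsLocalSpec`).  For a measurable "forbidden" set `F ⊆ Phase` the
**hard-core void functional** is the probability
`Z(F) = P{ζ | ζ is hard core and has no point in F}` — the grand-canonical hard-sphere partition
function in the volume carrying `m`, with the region `F` excluded, normalised by the ideal-gas one
(boundary conditions enter through `F = ⋃_{y ∈ η} B°_σ(y)`).  Everything below is elementary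
Poisson calculus (Mecke's formula, proved in the tree) and is the void-probability form of the
one-point recursion of Michelen–Perkins:

* `isHardCore_union_iff`, `isHardCore_union_ofFn_one_iff` — hard core of a superposition / after
  inserting a point (`c ∪ {a}` is hard core iff `c` is and `c` has no point in the ball window
  `B°_σ(a) = {y | dist y.1 a.1 < σ}`);
* `measure_hardCore_void_pos` — `Z(F) ≥ P{∅} = e^{-m(Phase)} > 0`;
* **the first-point identity** (`measure_hardCore_void_count_ne_zero_eq_lintegral`,
  `measureReal_hardCore_void_sub_eq_integral`; Michelen–Perkins 2021, §3.3, Lemma 17–18 and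
  Prop. 23: the identity behind `ρ(v) = λ(v) exp(-∫ ρ_{v→w}(w) (1 - e^{-φ}) dw)`, obtained from
  the GNZ/Mecke equation by retaining, among the points of the process in a region, the FIRST one
  for a fixed linear order — there "by distance to `v`", here by the first position coordinate,
  which is a.s. injective on the process):
  `Z(F) - Z(F ∪ S) = ∫_S 1[x ∉ F] · Z(F ∪ (S ∩ H_x) ∪ B°_σ(x)) m(dx)`, `H_x = {y | y₁ < x₁}`;
* `ratio_union` — the telescoping rule `Z(F ∪ A ∪ B)/Z(F) = (Z(F ∪ A)/Z(F)) · (Z(F ∪ A ∪ B)/Z(F ∪ A))`;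
* **decay of boundary influence on the ratios** (`abs_ratio_sub_ratio_le_pow`; the contraction
  step of Michelen–Perkins 2021, §5.1, Lemma 26–28, in crude form): for two finite Poisson hard-core
  systems whose intensities and forbidden sets agree on the window of a region `G`, and a ball
  window `S ⊆ B°_σ(a)` with `ball(a, (k+1)σ) ⊆ G`,
  `|Z₁(F₁ ∪ S)/Z₁(F₁) - Z₂(F₂ ∪ S)/Z₂(F₂)| ≤ (2κ)^k` whenever both intensities give mass `≤ κ` to
  every ball window `B°_σ(·)` — by induction on `k`, each application of the first-point identity
  costing a factor `m(S) · 2 ≤ 2κ` and one step `σ` towards the complement of `G`.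

## References

* M. Michelen, W. Perkins, *Potential-weighted connective constants and uniqueness of Gibbs
  measures*, arXiv:2109.01094 (Comm. Math. Phys. 2023), §3.3 (integral identities from GNZ),
  §5.1 (contraction). [MichelenPerkins2021]
* G. Last, M. Penrose, *Lectures on the Poisson Process* (2017), Thm 4.1 (Mecke equation).
-/

noncomputable section

open MeasureTheory ProbabilityTheory Set Filter
open scoped ENNReal NNReal

namespace Literature.MathematicalPhysics.KineticTheory

open Literature.Analysis.FunctionSpaces
open Literature.MathematicalPhysics.StatisticalMechanics
open Literature.MathematicalPhysics.StatisticalMechanics.HardSphere (Pos Phase window hardCoreSet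
  glue poissonLaw IsHardCore)

/-! ### Configuration algebra on `PointConfig Phase` -/

/-- Membership in a restricted configuration. [folklore] -/
theorem mem_restrict_iff {s : Set Phase} {c : PointConfig Phase} {x : Phase} :
    x ∈ c.restrict s ↔ x ∈ c ∧ x ∈ s := Iff.rfl

/-- A configuration has no point in `s` iff every point lies outside `s`. [folklore] -/
theorem count_eq_zero_iff' {c : PointConfig Phase} {s : Set Phase} :
    c.count s = 0 ↔ ∀ x ∈ c, x ∉ s := by
  rw [PointConfig.count, Set.encard_eq_zero, Set.eq_empty_iff_forall_notMem]
  simp only [mem_inter_iff, not_and, PointConfig.mem_carrier]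

/-- No point in a union iff no point in either part. [folklore] -/
theorem count_union_eq_zero_iff {c : PointConfig Phase} {s t : Set Phase} :
    c.count (s ∪ t) = 0 ↔ c.count s = 0 ∧ c.count t = 0 := by
  simp only [count_eq_zero_iff', mem_union, not_or]
  exact ⟨fun h => ⟨fun x hx => (h x hx).1, fun x hx => (h x hx).2⟩,
    fun h x hx => ⟨h.1 x hx, h.2 x hx⟩⟩

/-- A configuration without any point is the empty configuration. [folklore] -/
theorem eq_empty_of_count_univ_eq_zero {c : PointConfig Phase} (h : c.count univ = 0) :
    c = ∅ := by
  rw [count_eq_zero_iff'] at h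
  exact PointConfig.ext fun x => ⟨fun hx => absurd (mem_univ x) (h x hx), fun hx => absurd hx (by
    change x ∉ (∅ : PointConfig Phase).carrier; simp)⟩

/-- The first position coordinate `y ↦ y.1 0` is measurable on phase space. [folklore] -/
theorem measurable_fst_apply_zero : Measurable fun y : Phase => y.1 0 :=
  RiemannDatum.measurable_apply_zero.comp measurable_fst

/-- The ball window `B°_σ(a) = {y | dist y.1 a.1 < σ}` is the window of the open ball.
[folklore] -/
theorem mem_window_ball {σ : ℝ} {a y : Phase} : y ∈ window (Metric.ball a.1 σ) ↔ dist y.1 a.1 < σ := by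
  rw [HardSphere.mem_window, Metric.mem_ball]

/-- The ball window is measurable. [folklore] -/
theorem measurableSet_window_ball (σ : ℝ) (a : Phase) : MeasurableSet (window (Metric.ball a.1 σ)) :=
  HardSphere.measurableSet_window Metric.isOpen_ball.measurableSet

/-- The "earlier" half-space `H_x = {y | y₁ < x₁}` is measurable. [folklore] -/
theorem measurableSet_halfBelow (x : Phase) : MeasurableSet {y : Phase | y.1 0 < x.1 0} :=
  measurableSet_lt measurable_fst_apply_zero measurable_const

/-- **Hard core of a superposition**: `c ∪ d` is hard core iff both are and distinct points of
`c` and `d` are `σ`-separated in position. [folklore] -/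
theorem isHardCore_union_iff {σ : ℝ} {c d : PointConfig Phase} :
    IsHardCore σ (c ∪ d) ↔ IsHardCore σ c ∧ IsHardCore σ d ∧
      ∀ x ∈ c, ∀ y ∈ d, x ≠ y → σ ≤ dist x.1 y.1 := by
  constructor
  · intro h
    exact ⟨h.of_subset fun x hx => Or.inl hx, h.of_subset fun x hx => Or.inr hx,
      fun x hx y hy hxy => h x (Or.inl hx) y (Or.inr hy) hxy⟩
  · rintro ⟨hc, hd, hcd⟩ x hx y hy hxy
    rw [PointConfig.mem_union] at hx hy
    rcases hx with hx | hx <;> rcases hy with hy | hy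
    · exact hc x hx y hy hxy
    · exact hcd x hx y hy hxy
    · rw [dist_comm]; exact hcd y hy x hx (Ne.symm hxy)
    · exact hd x hx y hy hxy

/-- **Hard core after inserting a point** `a ∉ c`: `c ∪ {a}` is hard core iff `c` is hard core
and has no point in the ball window `B°_σ(a)`. [folklore] -/
theorem isHardCore_union_ofFn_one_iff {σ : ℝ} {c : PointConfig Phase} {a : Phase} (ha : a ∉ c) :
    IsHardCore σ (c ∪ PointConfig.ofFn (fun _ : Fin 1 => a)) ↔
      IsHardCore σ c ∧ c.count (window (Metric.ball a.1 σ)) = 0 := by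
  have h1 : IsHardCore σ (PointConfig.ofFn (fun _ : Fin 1 => a)) := by
    intro x hx y hy hxy
    obtain ⟨_, rfl⟩ := (PointConfig.mem_ofFn).1 hx
    obtain ⟨_, rfl⟩ := (PointConfig.mem_ofFn).1 hy
    exact absurd rfl hxy
  rw [isHardCore_union_iff, count_eq_zero_iff']
  simp only [h1, true_and]
  constructor
  · rintro ⟨hc, h⟩
    refine ⟨hc, fun x hx hxa => ?_⟩
    rw [mem_window_ball] at hxa
    have hne : x ≠ a := fun hxa' => ha (hxa' ▸ hx)
    exact absurd hxa (not_lt.2 (h x hx a (PointConfig.apply_mem_ofFn _ 0) hne))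
  · rintro ⟨hc, h⟩
    refine ⟨hc, fun x hx y hy _ => ?_⟩
    obtain ⟨_, rfl⟩ := (PointConfig.mem_ofFn).1 hy
    exact not_lt.1 fun hlt => h x hx (mem_window_ball.2 hlt)

/-! ### The finite Poisson gas: basic probabilities -/

section Poisson

variable {σ : ℝ} {m : Measure Phase} {P : Measure (PointConfig Phase)}

/-- The hard-core void event `{hard core} ∩ {no point in F}` is measurable. [folklore] -/
theorem measurableSet_hardCore_void (σ : ℝ) {F : Set Phase} (hF : MeasurableSet F) :
    MeasurableSet (hardCoreSet σ ∩ {ζ : PointConfig Phase | ζ.count F = 0}) :=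
  (HardSphere.measurableSet_hardCoreSet σ).inter
    (PointConfig.measurable_count hF (measurableSet_singleton 0))

/-- The void event of a measurable set is measurable. [folklore] -/
theorem measurableSet_count_eq_zero {F : Set Phase} (hF : MeasurableSet F) :
    MeasurableSet {ζ : PointConfig Phase | ζ.count F = 0} :=
  PointConfig.measurable_count hF (measurableSet_singleton 0)

/-- The event "some point in `S`" is measurable. [folklore] -/
theorem measurableSet_count_ne_zero {S : Set Phase} (hS : MeasurableSet S) :
    MeasurableSet {ζ : PointConfig Phase | ζ.count S ≠ 0} :=
  (PointConfig.measurable_count hS (measurableSet_singleton 0)).compl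

/-- The empty configuration belongs to every hard-core void event. [folklore] -/
theorem setOf_count_univ_subset_hardCore_void (σ : ℝ) (F : Set Phase) :
    {ζ : PointConfig Phase | ζ.count univ = 0} ⊆ hardCoreSet σ ∩ {ζ | ζ.count F = 0} := by
  intro ζ hζ
  have h := eq_empty_of_count_univ_eq_zero hζ
  subst h
  exact ⟨HardSphere.isHardCore_empty σ, PointConfig.count_empty F⟩

/-- **Void probability of the whole space** for a finite intensity: `P{∅} = e^{-m(Phase)}`.
[cite: Kingman1993, §2.1] -/
theorem measure_count_univ_eq_zero [IsFiniteMeasure m] (hP : IsPoissonPointProcess m P) :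
    P {ζ : PointConfig Phase | ζ.count univ = 0} = ENNReal.ofReal (Real.exp (-(m univ).toReal)) :=
  hP.measure_count_eq_zero MeasurableSet.univ (measure_ne_top m _)

/-- **The hard-core void probabilities are positive**: `Z(F) ≥ P{∅} = e^{-m(Phase)} > 0`
("positivity of the partition function by considering the empty configuration").
[cite: MichelenPerkins2021, §3.2] -/
theorem exp_le_measure_hardCore_void [IsFiniteMeasure m] (hP : IsPoissonPointProcess m P)
    (σ : ℝ) (F : Set Phase) :
    ENNReal.ofReal (Real.exp (-(m univ).toReal)) ≤ P (hardCoreSet σ ∩ {ζ | ζ.count F = 0}) := by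
  rw [← measure_count_univ_eq_zero hP]
  exact measure_mono (setOf_count_univ_subset_hardCore_void σ F)

/-- Real-valued form: `e^{-m(Phase)} ≤ Z(F)`. [cite: MichelenPerkins2021, §3.2] -/
theorem exp_le_measureReal_hardCore_void [IsFiniteMeasure m] (hP : IsPoissonPointProcess m P)
    (σ : ℝ) (F : Set Phase) :
    Real.exp (-(m univ).toReal) ≤ P.real (hardCoreSet σ ∩ {ζ | ζ.count F = 0}) := by
  haveI := hP.isProbabilityMeasure
  rw [measureReal_def, ← ENNReal.ofReal_le_iff_le_toReal (measure_ne_top P _)]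
  exact exp_le_measure_hardCore_void hP σ F

/-- Hence `Z(F) > 0`. [cite: MichelenPerkins2021, §3.2] -/
theorem measureReal_hardCore_void_pos [IsFiniteMeasure m] (hP : IsPoissonPointProcess m P)
    (σ : ℝ) (F : Set Phase) : 0 < P.real (hardCoreSet σ ∩ {ζ | ζ.count F = 0}) :=
  lt_of_lt_of_le (Real.exp_pos _) (exp_le_measureReal_hardCore_void hP σ F)

/-- And `Z(F) ≤ 1`. [folklore] -/
theorem measureReal_hardCore_void_le_one (hP : IsPoissonPointProcess m P) (σ : ℝ) (F : Set Phase) :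
    P.real (hardCoreSet σ ∩ {ζ | ζ.count F = 0}) ≤ 1 := by
  haveI := hP.isProbabilityMeasure
  exact measureReal_le_one

/-- `Z` is antitone in the forbidden set. [folklore] -/
theorem measureReal_hardCore_void_mono (hP : IsPoissonPointProcess m P) (σ : ℝ) {F G : Set Phase}
    (h : F ⊆ G) :
    P.real (hardCoreSet σ ∩ {ζ | ζ.count G = 0}) ≤ P.real (hardCoreSet σ ∩ {ζ | ζ.count F = 0}) := by
  haveI := hP.isProbabilityMeasure
  refine measureReal_mono (fun ζ hζ => ⟨hζ.1, ?_⟩) (measure_ne_top P _)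
  have h2 : ζ.count G = 0 := hζ.2
  change ζ.count F = 0
  rw [count_eq_zero_iff'] at h2 ⊢
  exact fun x hx hxF => h2 x hx (h hxF)

end Poisson

/-! ### The first-point identity (Mecke's formula) -/

section FirstPoint

variable {σ : ℝ} {m : Measure Phase} {P : Measure (PointConfig Phase)}

/-- The integrand of the first-point identity, as a set of pairs `(c, a)`: `a ∈ S`, no point of
`c` in `S` strictly before `a`, `c` hard core with no point in `F`. It is measurable (the
parametrised void event by the tree's counting-kernel measurability). [folklore] -/
theorem measurableSet_firstPoint (σ : ℝ) {F S : Set Phase} (hF : MeasurableSet F)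
    (hS : MeasurableSet S) :
    MeasurableSet {p : PointConfig Phase × Phase | p.2 ∈ S ∧
      p.1.count (S ∩ {y | y.1 0 < p.2.1 0}) = 0 ∧ IsHardCore σ p.1 ∧ p.1.count F = 0} := by
  have h1 : MeasurableSet {p : PointConfig Phase × Phase | p.2 ∈ S} := hS.preimage measurable_snd
  have ht : MeasurableSet {q : (PointConfig Phase × Phase) × Phase |
      q.2 ∈ S ∧ q.2.1 0 < q.1.2.1 0} :=
    (hS.preimage measurable_snd).inter
      (measurableSet_lt (measurable_fst_apply_zero.comp measurable_snd)
        (measurable_fst_apply_zero.comp (measurable_snd.comp measurable_fst)))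
  have h2 : MeasurableSet {p : PointConfig Phase × Phase |
      p.1.count (S ∩ {y | y.1 0 < p.2.1 0}) = 0} :=
    PointConfig.measurableSet_count_preimage_eq_zero ht measurable_fst
  have h3 : MeasurableSet {p : PointConfig Phase × Phase | IsHardCore σ p.1} :=
    (HardSphere.measurableSet_hardCoreSet σ).preimage measurable_fst
  have h4 : MeasurableSet {p : PointConfig Phase × Phase | p.1.count F = 0} :=
    (measurableSet_count_eq_zero hF).preimage measurable_fst
  exact h1.inter (h2.inter (h3.inter h4))

/-- **Summing the first-point integrand over the points of a finite configuration with pairwise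
distinct first coordinates gives the indicator of "hard core, no point in `F`, some point in
`S`"**: exactly one point of `c ∩ S` — the first one — contributes. [folklore] -/
theorem tsum_firstPoint_indicator (σ : ℝ) (F S : Set Phase) {c : PointConfig Phase}
    (hfin : (c : Set Phase).Finite) (hinj : InjOn (fun y : Phase => y.1 0) (c : Set Phase)) :
    (∑' a : (c : Set Phase), ({p : PointConfig Phase × Phase | p.2 ∈ S ∧
        p.1.count (S ∩ {y | y.1 0 < p.2.1 0}) = 0 ∧ IsHardCore σ p.1 ∧ p.1.count F = 0}).indicator
          (1 : PointConfig Phase × Phase → ℝ≥0∞) (c, (a : Phase))) =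
      (hardCoreSet σ ∩ {ζ : PointConfig Phase | ζ.count F = 0} ∩ {ζ | ζ.count S ≠ 0}).indicator 1 c := by
  classical
  set T := {p : PointConfig Phase × Phase | p.2 ∈ S ∧
    p.1.count (S ∩ {y | y.1 0 < p.2.1 0}) = 0 ∧ IsHardCore σ p.1 ∧ p.1.count F = 0} with hT
  by_cases hc : IsHardCore σ c ∧ c.count F = 0
  · by_cases hS : c.count S = 0
    · -- no point in `S`: every term vanishes
      have hzero : ∀ a : (c : Set Phase), T.indicator (1 : PointConfig Phase × Phase → ℝ≥0∞)
          (c, (a : Phase)) = 0 := fun a => by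
        rw [indicator_of_notMem]
        rintro ⟨haS, -⟩
        exact (count_eq_zero_iff'.1 hS) a a.2 haS
      rw [ENNReal.tsum_eq_zero.2 hzero, indicator_of_notMem]
      exact fun h => h.2 hS
    · -- the first point of `c ∩ S`
      have hne : (c.carrier ∩ S).Nonempty := by
        rw [nonempty_iff_ne_empty]
        intro h
        exact hS (by rw [PointConfig.count, h, Set.encard_empty])
      obtain ⟨a₀, ha₀, hmin⟩ := Set.exists_min_image _ (fun y : Phase => y.1 0)
        (hfin.subset inter_subset_left) hne
      have ha₀c : a₀ ∈ (c : Set Phase) := ha₀.1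
      rw [tsum_eq_single ⟨a₀, ha₀c⟩]
      · rw [indicator_of_mem, indicator_of_mem]
        · rfl
        · exact ⟨hc, hS⟩
        · refine ⟨ha₀.2, ?_, hc.1, hc.2⟩
          rw [count_eq_zero_iff']
          rintro b hb ⟨hbS, hblt⟩
          exact absurd (hmin b ⟨hb, hbS⟩) (not_le.2 hblt)
      · rintro ⟨b, hb⟩ hba
        rw [indicator_of_notMem]
        rintro ⟨hbS, hbcount, -, -⟩
        have hne' : (b : Phase) ≠ a₀ := fun h => hba (Subtype.ext h)
        have hlt : a₀.1 0 < (b : Phase).1 0 :=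
          lt_of_le_of_ne (hmin b ⟨hb, hbS⟩) fun h => hne' (hinj hb ha₀c h.symm)
        exact (count_eq_zero_iff'.1 hbcount) a₀ ha₀c ⟨ha₀.2, hlt⟩
  · -- not hard core or a point in `F`: both sides vanish
    have hzero : ∀ a : (c : Set Phase), T.indicator (1 : PointConfig Phase × Phase → ℝ≥0∞)
        (c, (a : Phase)) = 0 := fun a => by
      rw [indicator_of_notMem]
      rintro ⟨-, -, h1, h2⟩
      exact hc ⟨h1, h2⟩
    rw [ENNReal.tsum_eq_zero.2 hzero, indicator_of_notMem]
    rintro ⟨⟨h1, h2⟩, -⟩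
    exact hc ⟨h1, h2⟩

/-- **Inserting a point `a ∉ c` into the first-point integrand**: `(c ∪ {a}, a)` qualifies iff
`a ∈ S ∖ F` and `c` is hard core with no point in `F ∪ (S ∩ H_a) ∪ B°_σ(a)`. [folklore] -/
theorem insert_mem_firstPoint_iff (σ : ℝ) (F S : Set Phase) {c : PointConfig Phase} {a : Phase}
    (ha : a ∉ c) :
    (c ∪ PointConfig.ofFn (fun _ : Fin 1 => a), a) ∈ {p : PointConfig Phase × Phase | p.2 ∈ S ∧
        p.1.count (S ∩ {y | y.1 0 < p.2.1 0}) = 0 ∧ IsHardCore σ p.1 ∧ p.1.count F = 0} ↔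
      a ∈ S ∩ Fᶜ ∧ c ∈ hardCoreSet σ ∩ {ζ : PointConfig Phase |
        ζ.count (F ∪ ((S ∩ {y | y.1 0 < a.1 0}) ∪ window (Metric.ball a.1 σ))) = 0} := by
  classical
  simp only [mem_setOf_eq, mem_inter_iff, mem_compl_iff, HardSphere.mem_hardCoreSet]
  rw [PointConfig.count_union_ofFn_one, PointConfig.count_union_ofFn_one,
    isHardCore_union_ofFn_one_iff ha, count_union_eq_zero_iff, count_union_eq_zero_iff,
    if_neg (fun h => lt_irrefl _ (show a.1 0 < a.1 0 from h.1.2))]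
  simp only [add_zero, ha, not_false_eq_true, and_true]
  constructor
  · rintro ⟨haS, h1, ⟨h2, h3⟩, h4⟩
    have h5 : c.count F = 0 ∧ a ∉ F := by
      by_cases haF : a ∈ F
      · rw [if_pos haF] at h4; simp at h4
      · rw [if_neg haF, add_zero] at h4; exact ⟨h4, haF⟩
    exact ⟨⟨haS, h5.2⟩, h2, h5.1, h1, h3⟩
  · rintro ⟨⟨haS, haF⟩, h2, h5, h1, h3⟩
    refine ⟨haS, h1, ⟨h2, h3⟩, ?_⟩
    rw [if_neg haF, add_zero]
    exact h5

variable [IsFiniteMeasure m]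

/-- **The first-point identity, probability form** (Michelen–Perkins 2021, §3.3: the GNZ/Mecke
identity with the points of a region ordered, here by their first coordinate): the probability
that the Poisson gas is hard core, has no point in `F`, and has SOME point in `S` is
`∫_S 1[x ∉ F] · P{hard core, no point in F ∪ (S ∩ H_x) ∪ B°_σ(x)} m(dx)` — decompose the event
according to the first point `x` of the process in `S`. Requires the first coordinate to be a.s.
injective on the process (`m` charges no hyperplane `{y₁ = t}`).
[cite: MichelenPerkins2021, §3.3, Lemma 17] -/
theorem measure_hardCore_void_count_ne_zero_eq_lintegral (hP : IsPoissonPointProcess m P)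
    (hm : ∀ t : ℝ, m {y : Phase | y.1 0 = t} = 0) (σ : ℝ) {F S : Set Phase}
    (hF : MeasurableSet F) (hS : MeasurableSet S) :
    P (hardCoreSet σ ∩ {ζ : PointConfig Phase | ζ.count F = 0} ∩ {ζ | ζ.count S ≠ 0}) =
      ∫⁻ x in S, Fᶜ.indicator (1 : Phase → ℝ≥0∞) x *
        P (hardCoreSet σ ∩ {ζ : PointConfig Phase |
          ζ.count (F ∪ ((S ∩ {y | y.1 0 < x.1 0}) ∪ window (Metric.ball x.1 σ))) = 0}) ∂m := by
  classical
  haveI := hP.isProbabilityMeasure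
  set T := {p : PointConfig Phase × Phase | p.2 ∈ S ∧
    p.1.count (S ∩ {y | y.1 0 < p.2.1 0}) = 0 ∧ IsHardCore σ p.1 ∧ p.1.count F = 0} with hT
  have hTm : MeasurableSet T := measurableSet_firstPoint σ hF hS
  have hMecke := hP.lintegral_tsum_eq_lintegral_lintegral_insert (measurable_one.indicator hTm)
  -- left-hand side: a.s. the sum over the points is the indicator of the event
  have hfin : ∀ᵐ c ∂P, ((c : PointConfig Phase) : Set Phase).Finite := hP.ae_finite (measure_ne_top m _)
  have hinj : ∀ᵐ c ∂P, InjOn (fun y : Phase => y.1 0) ((c : PointConfig Phase) : Set Phase) :=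
    hP.ae_injOn measurable_fst_apply_zero (fun t => hm t)
  have hE : MeasurableSet (hardCoreSet σ ∩ {ζ : PointConfig Phase | ζ.count F = 0} ∩
      {ζ | ζ.count S ≠ 0}) :=
    (measurableSet_hardCore_void σ hF).inter (measurableSet_count_ne_zero hS)
  have hL : ∫⁻ c, ∑' a : ((c : PointConfig Phase) : Set Phase),
      T.indicator (1 : PointConfig Phase × Phase → ℝ≥0∞) (c, (a : Phase)) ∂P =
      P (hardCoreSet σ ∩ {ζ : PointConfig Phase | ζ.count F = 0} ∩ {ζ | ζ.count S ≠ 0}) := by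
    rw [← lintegral_indicator_one hE]
    refine lintegral_congr_ae ?_
    filter_upwards [hfin, hinj] with c hc hc'
    exact tsum_firstPoint_indicator σ F S hc hc'
  -- right-hand side: insert the point and integrate
  have hR : ∀ a : Phase, ∫⁻ c, T.indicator (1 : PointConfig Phase × Phase → ℝ≥0∞)
      (c ∪ PointConfig.ofFn (fun _ : Fin 1 => a), a) ∂P =
      (S ∩ Fᶜ).indicator (1 : Phase → ℝ≥0∞) a *
        P (hardCoreSet σ ∩ {ζ : PointConfig Phase |
          ζ.count (F ∪ ((S ∩ {y | y.1 0 < a.1 0}) ∪ window (Metric.ball a.1 σ))) = 0}) := by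
    intro a
    have hEa : MeasurableSet (hardCoreSet σ ∩ {ζ : PointConfig Phase |
        ζ.count (F ∪ ((S ∩ {y | y.1 0 < a.1 0}) ∪ window (Metric.ball a.1 σ))) = 0}) :=
      measurableSet_hardCore_void σ
        (hF.union ((hS.inter (measurableSet_halfBelow a)).union (measurableSet_window_ball σ a)))
    have hnot : ∀ᵐ c ∂P, a ∉ (c : PointConfig Phase) := by
      have h0 := hP.measure_setOf_mem_eq_zero (measurableSet_singleton a)
      rw [ae_iff]
      simpa only [not_not] using h0
    rw [← lintegral_indicator_one hEa, ← lintegral_const_mul _ (measurable_one.indicator hEa)]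
    refine lintegral_congr_ae ?_
    filter_upwards [hnot] with c hc
    have key := insert_mem_firstPoint_iff σ F S (c := c) (a := a) hc
    by_cases h1 : (c ∪ PointConfig.ofFn (fun _ : Fin 1 => a), a) ∈ T
    · obtain ⟨h2, h3⟩ := key.1 h1
      rw [indicator_of_mem h1, indicator_of_mem h2, indicator_of_mem h3]
      simp
    · rw [indicator_of_notMem h1]
      by_cases h2 : a ∈ S ∩ Fᶜ
      · have h3 : c ∉ hardCoreSet σ ∩ {ζ : PointConfig Phase |
            ζ.count (F ∪ ((S ∩ {y | y.1 0 < a.1 0}) ∪ window (Metric.ball a.1 σ))) = 0} :=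
          fun h3 => h1 (key.2 ⟨h2, h3⟩)
        rw [indicator_of_notMem h3, mul_zero]
      · rw [indicator_of_notMem h2, zero_mul]
  rw [← hL, hMecke]
  simp_rw [hR]
  rw [← lintegral_indicator hS]
  refine lintegral_congr fun a => ?_
  by_cases haS : a ∈ S
  · rw [indicator_of_mem haS]
    by_cases haF : a ∈ F
    · rw [indicator_of_notMem (fun h : a ∈ S ∩ Fᶜ => h.2 haF),
        indicator_of_notMem (fun h : a ∈ Fᶜ => h haF)]
    · rw [indicator_of_mem (show a ∈ S ∩ Fᶜ from ⟨haS, haF⟩), indicator_of_mem (show a ∈ Fᶜ from haF)]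
  · rw [indicator_of_notMem haS, indicator_of_notMem (fun h : a ∈ S ∩ Fᶜ => haS h.1), zero_mul]

/-- **The first-point identity, partition-function form**:
`Z(F) = Z(F ∪ S) + ∫_S 1[x ∉ F] Z(F ∪ (S ∩ H_x) ∪ B°_σ(x)) m(dx)` in `ℝ≥0∞`.
[cite: MichelenPerkins2021, §3.3, Lemma 17] -/
theorem measure_hardCore_void_eq_add_lintegral (hP : IsPoissonPointProcess m P)
    (hm : ∀ t : ℝ, m {y : Phase | y.1 0 = t} = 0) (σ : ℝ) {F S : Set Phase}
    (hF : MeasurableSet F) (hS : MeasurableSet S) :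
    P (hardCoreSet σ ∩ {ζ : PointConfig Phase | ζ.count F = 0}) =
      P (hardCoreSet σ ∩ {ζ : PointConfig Phase | ζ.count (F ∪ S) = 0}) +
        ∫⁻ x in S, Fᶜ.indicator (1 : Phase → ℝ≥0∞) x *
          P (hardCoreSet σ ∩ {ζ : PointConfig Phase |
            ζ.count (F ∪ ((S ∩ {y | y.1 0 < x.1 0}) ∪ window (Metric.ball x.1 σ))) = 0}) ∂m := by
  rw [← measure_hardCore_void_count_ne_zero_eq_lintegral hP hm σ hF hS]
  have h1 : hardCoreSet σ ∩ {ζ : PointConfig Phase | ζ.count (F ∪ S) = 0} =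
      (hardCoreSet σ ∩ {ζ : PointConfig Phase | ζ.count F = 0}) ∩ {ζ | ζ.count S = 0} := by
    ext ζ
    simp only [mem_inter_iff, mem_setOf_eq, count_union_eq_zero_iff, and_assoc]
  have h2 : hardCoreSet σ ∩ {ζ : PointConfig Phase | ζ.count F = 0} ∩ {ζ | ζ.count S ≠ 0} =
      (hardCoreSet σ ∩ {ζ : PointConfig Phase | ζ.count F = 0}) \ {ζ | ζ.count S = 0} := by
    ext ζ
    simp only [mem_inter_iff, mem_setOf_eq, Set.mem_sdiff]
  rw [h1, h2, measure_inter_add_sdiff _ (measurableSet_count_eq_zero hS)]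

end FirstPoint

/-! ### Ratios of hard-core void probabilities: recursion, telescoping, decay -/

section Ratio

variable {σ : ℝ} {m : Measure Phase} {P : Measure (PointConfig Phase)}

/-- The parametrised hard-core void probability of the first-point identity,
`x ↦ P{hard core, no point in F ∪ (S ∩ H_x) ∪ B°_σ(x)}`, is measurable. [folklore] -/
theorem measurable_measure_hardCore_void_firstPoint (σ : ℝ) {F S : Set Phase}
    (hF : MeasurableSet F) (hS : MeasurableSet S) (P : Measure (PointConfig Phase)) [SFinite P] :
    Measurable fun x : Phase => P (hardCoreSet σ ∩ {ζ : PointConfig Phase |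
      ζ.count (F ∪ ((S ∩ {y | y.1 0 < x.1 0}) ∪ window (Metric.ball x.1 σ))) = 0}) := by
  set t : Set ((Phase × PointConfig Phase) × Phase) := {q |
    q.2 ∈ F ∨ ((q.2 ∈ S ∧ q.2.1 0 < q.1.1.1 0) ∨ dist q.2.1 q.1.1.1 < σ)} with ht_def
  have ht : MeasurableSet t := by
    refine (hF.preimage measurable_snd).union (MeasurableSet.union ?_ ?_)
    · exact (hS.preimage measurable_snd).inter
        (measurableSet_lt (measurable_fst_apply_zero.comp measurable_snd)
          (measurable_fst_apply_zero.comp (measurable_fst.comp measurable_fst)))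
    · exact measurableSet_lt ((measurable_fst.comp measurable_snd).dist
        (measurable_fst.comp (measurable_fst.comp measurable_fst))) measurable_const
  set A : Set (Phase × PointConfig Phase) := {p | IsHardCore σ p.2 ∧
    p.2.count (Prod.mk p ⁻¹' t) = 0} with hA_def
  have hA : MeasurableSet A :=
    ((HardSphere.measurableSet_hardCoreSet σ).preimage measurable_snd).inter
      (PointConfig.measurableSet_count_preimage_eq_zero ht measurable_snd)
  have h := measurable_measure_prodMk_left (ν := P) hA
  have heq : (fun x : Phase => P (hardCoreSet σ ∩ {ζ : PointConfig Phase |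
      ζ.count (F ∪ ((S ∩ {y | y.1 0 < x.1 0}) ∪ window (Metric.ball x.1 σ))) = 0})) =
      fun x => P (Prod.mk x ⁻¹' A) := by
    funext x
    congr 1
    ext ζ
    have hpre : Prod.mk (x, ζ) ⁻¹' t =
        F ∪ ((S ∩ {y | y.1 0 < x.1 0}) ∪ window (Metric.ball x.1 σ)) := by
      ext y
      simp only [ht_def, mem_preimage, mem_setOf_eq, mem_union, mem_inter_iff, mem_window_ball]
    simp only [hA_def, mem_inter_iff, mem_setOf_eq, mem_preimage, HardSphere.mem_hardCoreSet, hpre]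
  rw [heq]
  exact h

variable [IsFiniteMeasure m]

/-- **The first-point identity, real form**:
`Z(F) = Z(F ∪ S) + ∫_S 1[x ∉ F] Z(F ∪ (S ∩ H_x) ∪ B°_σ(x)) m(dx)`.
[cite: MichelenPerkins2021, §3.3, Lemma 17] -/
theorem measureReal_hardCore_void_eq_add_integral (hP : IsPoissonPointProcess m P)
    (hm : ∀ t : ℝ, m {y : Phase | y.1 0 = t} = 0) (σ : ℝ) {F S : Set Phase}
    (hF : MeasurableSet F) (hS : MeasurableSet S) :
    P.real (hardCoreSet σ ∩ {ζ : PointConfig Phase | ζ.count F = 0}) =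
      P.real (hardCoreSet σ ∩ {ζ : PointConfig Phase | ζ.count (F ∪ S) = 0}) +
        ∫ x in S, Fᶜ.indicator (fun x => P.real (hardCoreSet σ ∩ {ζ : PointConfig Phase |
          ζ.count (F ∪ ((S ∩ {y | y.1 0 < x.1 0}) ∪ window (Metric.ball x.1 σ))) = 0})) x ∂m := by
  haveI := hP.isProbabilityMeasure
  have h := measure_hardCore_void_eq_add_lintegral hP hm σ hF hS
  set E : Phase → Set (PointConfig Phase) := fun x => hardCoreSet σ ∩ {ζ : PointConfig Phase |
    ζ.count (F ∪ ((S ∩ {y | y.1 0 < x.1 0}) ∪ window (Metric.ball x.1 σ))) = 0} with hE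
  set g : Phase → ℝ≥0∞ := fun x => Fᶜ.indicator (1 : Phase → ℝ≥0∞) x * P (E x) with hg
  have hgm : Measurable g :=
    (measurable_one.indicator hF.compl).mul (measurable_measure_hardCore_void_firstPoint σ hF hS P)
  have hg_le : ∀ x, g x ≤ 1 := fun x => by
    simp only [hg]
    by_cases hx : x ∈ Fᶜ
    · rw [indicator_of_mem hx, Pi.one_apply, one_mul]; exact prob_le_one
    · rw [indicator_of_notMem hx, zero_mul]; exact zero_le_one
  have hL : ∫⁻ x in S, g x ∂m ≠ ∞ := by
    refine ne_top_of_le_ne_top (measure_ne_top (m.restrict S) univ) ?_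
    calc ∫⁻ x in S, g x ∂m ≤ ∫⁻ _ in S, 1 ∂m := lintegral_mono fun x => hg_le x
      _ = (m.restrict S) univ := lintegral_one
  change P.real _ = P.real _ + ∫ x in S, Fᶜ.indicator (fun x => P.real (E x)) x ∂m
  rw [measureReal_def, measureReal_def, h, ENNReal.toReal_add (measure_ne_top _ _) hL]
  congr 1
  rw [← integral_toReal hgm.aemeasurable (Eventually.of_forall fun x =>
    lt_of_le_of_lt (hg_le x) ENNReal.one_lt_top)]
  refine integral_congr_ae (Eventually.of_forall fun x => ?_)
  simp only [hg]
  by_cases hx : x ∈ Fᶜ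
  · rw [indicator_of_mem hx, indicator_of_mem hx, Pi.one_apply, one_mul, measureReal_def]
  · rw [indicator_of_notMem hx, indicator_of_notMem hx, zero_mul, ENNReal.toReal_zero]

/-- `0 ≤ Z(F ∪ S)/Z(F)`. [folklore] -/
theorem ratio_nonneg (P : Measure (PointConfig Phase)) (σ : ℝ) (F S : Set Phase) :
    0 ≤ P.real (hardCoreSet σ ∩ {ζ : PointConfig Phase | ζ.count (F ∪ S) = 0}) /
      P.real (hardCoreSet σ ∩ {ζ : PointConfig Phase | ζ.count F = 0}) :=
  div_nonneg measureReal_nonneg measureReal_nonneg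

omit [IsFiniteMeasure m] in
/-- `Z(F ∪ S)/Z(F) ≤ 1`. [folklore] -/
theorem ratio_le_one (hP : IsPoissonPointProcess m P) (σ : ℝ) (F S : Set Phase) :
    P.real (hardCoreSet σ ∩ {ζ : PointConfig Phase | ζ.count (F ∪ S) = 0}) /
      P.real (hardCoreSet σ ∩ {ζ : PointConfig Phase | ζ.count F = 0}) ≤ 1 :=
  div_le_one_of_le₀ (measureReal_hardCore_void_mono hP σ subset_union_left) measureReal_nonneg

/-- **Telescoping of the ratios**:
`Z(F ∪ (A ∪ B))/Z(F) = (Z(F ∪ A)/Z(F)) · (Z((F ∪ A) ∪ B)/Z(F ∪ A))`.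
[cite: MichelenPerkins2021, §3.3, Lemma 20] -/
theorem ratio_union_eq_mul (hP : IsPoissonPointProcess m P) (σ : ℝ) (F A B : Set Phase) :
    P.real (hardCoreSet σ ∩ {ζ : PointConfig Phase | ζ.count (F ∪ (A ∪ B)) = 0}) /
        P.real (hardCoreSet σ ∩ {ζ : PointConfig Phase | ζ.count F = 0}) =
      (P.real (hardCoreSet σ ∩ {ζ : PointConfig Phase | ζ.count (F ∪ A) = 0}) /
          P.real (hardCoreSet σ ∩ {ζ : PointConfig Phase | ζ.count F = 0})) *
        (P.real (hardCoreSet σ ∩ {ζ : PointConfig Phase | ζ.count ((F ∪ A) ∪ B) = 0}) /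
          P.real (hardCoreSet σ ∩ {ζ : PointConfig Phase | ζ.count (F ∪ A) = 0})) := by
  have h1 := (measureReal_hardCore_void_pos hP σ (F ∪ A)).ne'
  rw [← union_assoc, div_mul_div_comm, mul_comm (P.real (hardCoreSet σ ∩ {ζ | ζ.count (F ∪ A) = 0})),
    mul_div_mul_right _ _ h1]

/-- **The first-point recursion for the ratios**:
`Z(F ∪ S)/Z(F) = 1 - ∫_S 1[x ∉ F] · Z(F ∪ (S ∩ H_x) ∪ B°_σ(x))/Z(F) m(dx)` — the void-probability
form of Michelen–Perkins' one-point density identity.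
[cite: MichelenPerkins2021, §3.3, Lemma 17 and Prop. 23] -/
theorem ratio_eq_one_sub_integral (hP : IsPoissonPointProcess m P)
    (hm : ∀ t : ℝ, m {y : Phase | y.1 0 = t} = 0) (σ : ℝ) {F S : Set Phase}
    (hF : MeasurableSet F) (hS : MeasurableSet S) :
    P.real (hardCoreSet σ ∩ {ζ : PointConfig Phase | ζ.count (F ∪ S) = 0}) /
        P.real (hardCoreSet σ ∩ {ζ : PointConfig Phase | ζ.count F = 0}) =
      1 - ∫ x in S, Fᶜ.indicator (fun x =>
        P.real (hardCoreSet σ ∩ {ζ : PointConfig Phase |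
          ζ.count (F ∪ ((S ∩ {y | y.1 0 < x.1 0}) ∪ window (Metric.ball x.1 σ))) = 0}) /
        P.real (hardCoreSet σ ∩ {ζ : PointConfig Phase | ζ.count F = 0})) x ∂m := by
  have hZ := measureReal_hardCore_void_pos hP σ F
  have h := measureReal_hardCore_void_eq_add_integral hP hm σ hF hS
  set Z := P.real (hardCoreSet σ ∩ {ζ : PointConfig Phase | ζ.count F = 0}) with hZdef
  set f : Phase → ℝ := fun x => P.real (hardCoreSet σ ∩ {ζ : PointConfig Phase |
    ζ.count (F ∪ ((S ∩ {y | y.1 0 < x.1 0}) ∪ window (Metric.ball x.1 σ))) = 0}) with hf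
  have hind : ∀ x, Fᶜ.indicator (fun x => f x / Z) x = Fᶜ.indicator f x / Z := fun x => by
    by_cases hx : x ∈ Fᶜ
    · rw [indicator_of_mem hx, indicator_of_mem hx]
    · rw [indicator_of_notMem hx, indicator_of_notMem hx, zero_div]
  change _ / Z = 1 - ∫ x in S, Fᶜ.indicator (fun x => f x / Z) x ∂m
  simp_rw [hind]
  rw [integral_div, eq_sub_iff_add_eq, ← add_div, ← h, div_self hZ.ne']

/-- Products of numbers in `[0, 1]` differ by at most the sum of the differences. [folklore] -/
theorem abs_mul_sub_mul_le {p₁ p₂ q₁ q₂ : ℝ} (hp₁ : 0 ≤ p₁) (hp₁' : p₁ ≤ 1) (hq₂ : 0 ≤ q₂)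
    (hq₂' : q₂ ≤ 1) : |p₁ * q₁ - p₂ * q₂| ≤ |p₁ - p₂| + |q₁ - q₂| := by
  calc |p₁ * q₁ - p₂ * q₂| = |p₁ * (q₁ - q₂) + (p₁ - p₂) * q₂| := by ring_nf
    _ ≤ |p₁ * (q₁ - q₂)| + |(p₁ - p₂) * q₂| := abs_add_le _ _
    _ = |p₁| * |q₁ - q₂| + |p₁ - p₂| * |q₂| := by rw [abs_mul, abs_mul]
    _ ≤ 1 * |q₁ - q₂| + |p₁ - p₂| * 1 := by
        gcongr
        · rw [abs_of_nonneg hp₁]; exact hp₁'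
        · rw [abs_of_nonneg hq₂]; exact hq₂'
    _ = |p₁ - p₂| + |q₁ - q₂| := by ring

/-- **Decay of boundary influence on the ratios** (the contraction step, Michelen–Perkins 2021
§5.1, in crude form with the trivial a-priori bound `Z(F ∪ S)/Z(F) ∈ [0, 1]`).  Two finite Poisson
hard-core systems `(m₁, P₁)`, `(m₂, P₂)` whose intensities agree on the window of a region `G`,
both giving mass `≤ κ` (for `m₁`) to every ball window, and two forbidden sets agreeing on the
window of `G`: for a test set `S` inside a ball window `B°_σ(a)` with `ball(a, (k+1)σ) ⊆ G`,
`|Z₁(F₁ ∪ S)/Z₁(F₁) - Z₂(F₂ ∪ S)/Z₂(F₂)| ≤ (2κ)^k`.  Induction on `k`: the first-point recursion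
expresses both ratios as `1 - ∫_S …` with the same measure and the same vanishing pattern on `S`,
the integrands are products of two ratios at depth `k` (telescoping), and `m₁(S) ≤ κ`.
[cite: MichelenPerkins2021, §5.1, Lemma 26–28] -/
theorem abs_ratio_sub_ratio_le_pow (hσ : 0 < σ) {κ : ℝ}
    {m₁ m₂ : Measure Phase} [IsFiniteMeasure m₁] [IsFiniteMeasure m₂]
    {P₁ P₂ : Measure (PointConfig Phase)}
    (hP₁ : IsPoissonPointProcess m₁ P₁) (hP₂ : IsPoissonPointProcess m₂ P₂)
    (hm₁ : ∀ t : ℝ, m₁ {y : Phase | y.1 0 = t} = 0) (hm₂ : ∀ t : ℝ, m₂ {y : Phase | y.1 0 = t} = 0)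
    (hκ : ∀ a : Pos, m₁.real (window (Metric.ball a σ)) ≤ κ)
    {G : Set Pos} (hG : m₁.restrict (window G) = m₂.restrict (window G)) (k : ℕ) :
    ∀ (a : Pos), Metric.ball a ((k + 1) * σ) ⊆ G →
    ∀ (S : Set Phase), MeasurableSet S → S ⊆ window (Metric.ball a σ) →
    ∀ (F₁ F₂ : Set Phase), MeasurableSet F₁ → MeasurableSet F₂ → F₁ ∩ window G = F₂ ∩ window G →
      |P₁.real (hardCoreSet σ ∩ {ζ : PointConfig Phase | ζ.count (F₁ ∪ S) = 0}) /
          P₁.real (hardCoreSet σ ∩ {ζ : PointConfig Phase | ζ.count F₁ = 0}) -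
        P₂.real (hardCoreSet σ ∩ {ζ : PointConfig Phase | ζ.count (F₂ ∪ S) = 0}) /
          P₂.real (hardCoreSet σ ∩ {ζ : PointConfig Phase | ζ.count F₂ = 0})| ≤ (2 * κ) ^ k := by
  haveI := hP₁.isProbabilityMeasure
  haveI := hP₂.isProbabilityMeasure
  have hκ0 : 0 ≤ κ := le_trans measureReal_nonneg (hκ 0)
  induction k with
  | zero =>
    intro a _ S _ _ F₁ F₂ _ _ _
    rw [pow_zero, abs_sub_le_iff]
    constructor
    · linarith [ratio_le_one hP₁ σ F₁ S, ratio_nonneg P₂ σ F₂ S]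
    · linarith [ratio_le_one hP₂ σ F₂ S, ratio_nonneg P₁ σ F₁ S]
  | succ k ih =>
    intro a ha S hS hSa F₁ F₂ hF₁ hF₂ hF
    -- geometry: `ball a σ ⊆ ball a ((k+1)σ) ⊆ ball a ((k+2)σ) ⊆ G`
    have hk1 : ((k : ℝ) + 1) * σ ≤ ((((k + 1 : ℕ)) : ℝ) + 1) * σ := by
      push_cast; nlinarith
    have hballk : Metric.ball a ((k + 1) * σ) ⊆ G := (Metric.ball_subset_ball hk1).trans ha
    have hball1 : Metric.ball a σ ⊆ G := by
      refine (Metric.ball_subset_ball ?_).trans ha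
      push_cast; nlinarith
    have hSG : S ⊆ window G := hSa.trans fun y hy => by
      rw [HardSphere.mem_window] at hy ⊢; exact hball1 hy
    -- notation
    set Z₁ : Set Phase → ℝ := fun F => P₁.real (hardCoreSet σ ∩ {ζ : PointConfig Phase | ζ.count F = 0})
      with hZ₁
    set Z₂ : Set Phase → ℝ := fun F => P₂.real (hardCoreSet σ ∩ {ζ : PointConfig Phase | ζ.count F = 0})
      with hZ₂
    set T : Phase → Set Phase := fun x => (S ∩ {y | y.1 0 < x.1 0}) ∪ window (Metric.ball x.1 σ)
      with hT
    set g₁ : Phase → ℝ := fun x => F₁ᶜ.indicator (fun x => Z₁ (F₁ ∪ T x) / Z₁ F₁) x with hg₁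
    set g₂ : Phase → ℝ := fun x => F₂ᶜ.indicator (fun x => Z₂ (F₂ ∪ T x) / Z₂ F₂) x with hg₂
    -- the two recursions, over the same measure
    have hrec₁ : Z₁ (F₁ ∪ S) / Z₁ F₁ = 1 - ∫ x in S, g₁ x ∂m₁ :=
      ratio_eq_one_sub_integral hP₁ hm₁ σ hF₁ hS
    have hrec₂ : Z₂ (F₂ ∪ S) / Z₂ F₂ = 1 - ∫ x in S, g₂ x ∂m₁ := by
      have hmS : m₂.restrict S = m₁.restrict S := by
        rw [← Measure.restrict_restrict_of_subset hSG, ← hG, Measure.restrict_restrict_of_subset hSG]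
      rw [← hmS]
      exact ratio_eq_one_sub_integral hP₂ hm₂ σ hF₂ hS
    -- measurability / integrability of the integrands
    have hg₁m : Measurable g₁ :=
      ((measurable_measure_hardCore_void_firstPoint σ hF₁ hS P₁).ennreal_toReal.div_const _).indicator
        hF₁.compl
    have hg₂m : Measurable g₂ :=
      ((measurable_measure_hardCore_void_firstPoint σ hF₂ hS P₂).ennreal_toReal.div_const _).indicator
        hF₂.compl
    have hg₁_bd : ∀ x, |g₁ x| ≤ 1 := fun x => by
      simp only [hg₁]
      by_cases hx : x ∈ F₁ᶜ
      · rw [indicator_of_mem hx, abs_of_nonneg (ratio_nonneg P₁ σ F₁ (T x))]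
        exact ratio_le_one hP₁ σ F₁ (T x)
      · rw [indicator_of_notMem hx, abs_zero]; exact zero_le_one
    have hg₂_bd : ∀ x, |g₂ x| ≤ 1 := fun x => by
      simp only [hg₂]
      by_cases hx : x ∈ F₂ᶜ
      · rw [indicator_of_mem hx, abs_of_nonneg (ratio_nonneg P₂ σ F₂ (T x))]
        exact ratio_le_one hP₂ σ F₂ (T x)
      · rw [indicator_of_notMem hx, abs_zero]; exact zero_le_one
    have hg₁i : Integrable g₁ (m₁.restrict S) :=
      Integrable.of_bound hg₁m.aestronglyMeasurable 1 (Eventually.of_forall fun x => by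
        rw [Real.norm_eq_abs]; exact hg₁_bd x)
    have hg₂i : Integrable g₂ (m₁.restrict S) :=
      Integrable.of_bound hg₂m.aestronglyMeasurable 1 (Eventually.of_forall fun x => by
        rw [Real.norm_eq_abs]; exact hg₂_bd x)
    -- pointwise bound on `S`
    have hpt : ∀ x ∈ S, ‖g₂ x - g₁ x‖ ≤ 2 * (2 * κ) ^ k := by
      intro x hx
      have hxG : x ∈ window G := hSG hx
      have hxa : dist x.1 a < σ := by
        have := hSa hx; rwa [HardSphere.mem_window, Metric.mem_ball] at this
      rw [Real.norm_eq_abs]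
      by_cases hx₁ : x ∈ F₁
      · have hx₂ : x ∈ F₂ := by
          have : x ∈ F₁ ∩ window G := ⟨hx₁, hxG⟩
          rw [hF] at this; exact this.1
        simp only [hg₁, hg₂, indicator_of_notMem (show x ∉ F₁ᶜ from fun h => h hx₁),
          indicator_of_notMem (show x ∉ F₂ᶜ from fun h => h hx₂), sub_zero, abs_zero]
        positivity
      · have hx₂ : x ∉ F₂ := fun hx₂ => by
          have : x ∈ F₂ ∩ window G := ⟨hx₂, hxG⟩
          rw [← hF] at this; exact hx₁ this.1
        simp only [hg₁, hg₂, indicator_of_mem (show x ∈ F₁ᶜ from hx₁),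
          indicator_of_mem (show x ∈ F₂ᶜ from hx₂)]
        -- telescoping
        rw [show F₁ ∪ T x = F₁ ∪ ((S ∩ {y | y.1 0 < x.1 0}) ∪ window (Metric.ball x.1 σ)) from rfl,
          show F₂ ∪ T x = F₂ ∪ ((S ∩ {y | y.1 0 < x.1 0}) ∪ window (Metric.ball x.1 σ)) from rfl,
          ratio_union_eq_mul hP₁ σ, ratio_union_eq_mul hP₂ σ, abs_sub_comm]
        -- the two factors at depth `k`
        have hA : |Z₁ (F₁ ∪ (S ∩ {y | y.1 0 < x.1 0})) / Z₁ F₁ -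
            Z₂ (F₂ ∪ (S ∩ {y | y.1 0 < x.1 0})) / Z₂ F₂| ≤ (2 * κ) ^ k :=
          ih a hballk (S ∩ {y | y.1 0 < x.1 0}) (hS.inter (measurableSet_halfBelow x))
            (inter_subset_left.trans hSa) F₁ F₂ hF₁ hF₂ hF
        have hball' : Metric.ball x.1 ((k + 1) * σ) ⊆ G := by
          intro q hq
          apply ha
          rw [Metric.mem_ball] at hq ⊢
          calc dist q a ≤ dist q x.1 + dist x.1 a := dist_triangle _ _ _
            _ < (k + 1) * σ + σ := add_lt_add hq hxa
            _ = (((k + 1 : ℕ) : ℝ) + 1) * σ := by push_cast; ring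
        have hF' : (F₁ ∪ (S ∩ {y | y.1 0 < x.1 0})) ∩ window G =
            (F₂ ∪ (S ∩ {y | y.1 0 < x.1 0})) ∩ window G := by
          rw [union_inter_distrib_right, union_inter_distrib_right, hF]
        have hB : |Z₁ ((F₁ ∪ (S ∩ {y | y.1 0 < x.1 0})) ∪ window (Metric.ball x.1 σ)) /
              Z₁ (F₁ ∪ (S ∩ {y | y.1 0 < x.1 0})) -
            Z₂ ((F₂ ∪ (S ∩ {y | y.1 0 < x.1 0})) ∪ window (Metric.ball x.1 σ)) /
              Z₂ (F₂ ∪ (S ∩ {y | y.1 0 < x.1 0}))| ≤ (2 * κ) ^ k :=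
          ih x.1 hball' (window (Metric.ball x.1 σ)) (measurableSet_window_ball σ x) subset_rfl
            _ _ (hF₁.union (hS.inter (measurableSet_halfBelow x)))
            (hF₂.union (hS.inter (measurableSet_halfBelow x))) hF'
        calc _ ≤ |Z₁ (F₁ ∪ (S ∩ {y | y.1 0 < x.1 0})) / Z₁ F₁ -
              Z₂ (F₂ ∪ (S ∩ {y | y.1 0 < x.1 0})) / Z₂ F₂| +
            |Z₁ ((F₁ ∪ (S ∩ {y | y.1 0 < x.1 0})) ∪ window (Metric.ball x.1 σ)) /
                Z₁ (F₁ ∪ (S ∩ {y | y.1 0 < x.1 0})) -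
              Z₂ ((F₂ ∪ (S ∩ {y | y.1 0 < x.1 0})) ∪ window (Metric.ball x.1 σ)) /
                Z₂ (F₂ ∪ (S ∩ {y | y.1 0 < x.1 0}))| :=
              abs_mul_sub_mul_le (ratio_nonneg P₁ σ _ _) (ratio_le_one hP₁ σ _ _)
                (ratio_nonneg P₂ σ _ _) (ratio_le_one hP₂ σ _ _)
          _ ≤ (2 * κ) ^ k + (2 * κ) ^ k := add_le_add hA hB
          _ = 2 * (2 * κ) ^ k := by ring
    -- integrate
    have hmS : m₁.real S ≤ κ := (measureReal_mono hSa (measure_ne_top _ _)).trans (hκ a)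
    change |Z₁ (F₁ ∪ S) / Z₁ F₁ - Z₂ (F₂ ∪ S) / Z₂ F₂| ≤ (2 * κ) ^ (k + 1)
    rw [hrec₁, hrec₂, show (1 - ∫ x in S, g₁ x ∂m₁) - (1 - ∫ x in S, g₂ x ∂m₁) =
      (∫ x in S, g₂ x ∂m₁) - ∫ x in S, g₁ x ∂m₁ by ring, ← integral_sub hg₂i hg₁i]
    calc |∫ x in S, (g₂ x - g₁ x) ∂m₁| = ‖∫ x in S, (g₂ x - g₁ x) ∂m₁‖ := (Real.norm_eq_abs _).symm
      _ ≤ 2 * (2 * κ) ^ k * m₁.real S :=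
          norm_setIntegral_le_of_norm_le_const (measure_lt_top _ _) hpt
      _ ≤ 2 * (2 * κ) ^ k * κ := by gcongr
      _ = (2 * κ) ^ (k + 1) := by ring

end Ratio

end Literature.MathematicalPhysics.KineticTheory

end
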